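import Summits.Ventures.CertifiedManyBodySolver.Certificates.HubbardSquare_tpm3o10_U29o5_toyKernelCert_bondRowQuot
import Summits.Ventures.CertifiedManyBodySolver.Rows.CorrWindowCertKernelChainQuotAdjCloser
import HarnessLib

/-!
# STEP-0 of the HINTED-QUOTIENT + ADJOINT replay: the ONE-ORIENTATION `↓` hopping word `2·c†_{0↓} c_{e₁↓}` at the La214-E station
# `(1, −3/10, 29/5)` — `Re ω ≥ −7/8 − (x − 7/8)` — from the bond certificate of `…_bondRowQuot`, which over RAW words leaves the
# ANTI-HERMITIAN residue `c†_{0↓}c_{e₁↓} − c†_{e₁↓}c_{0↓}`: closed by the AUTOMATIC adjoint canonicalisation of `stepEQA` (no hint, no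
# data) on top of the translation hint — ZERO hypotheses

HONEST FRAMING: a TOY and a TEMPLATE: same geometry, block, multiplier and hint as
`Certificates/HubbardSquare_tpm3o10_U29o5_toyKernelCert_bondRowQuot.lean` (`blocksq`, `muq`, `Dq`, `dΛq`), objective `TXh` = ONE orientation
of the bond word with coefficient `2`; the kernel's adjoint pass replaces `c†_{e₁↓}c_{0↓}` (larger key) by its adjoint's normal form
`c†_{0↓}c_{e₁↓}` and records `V = c†_{e₁↓}c_{0↓}` in the anti-Hermitian family; everything cancels (`toyH_last_nil`); closer
`affineOrbitLowerRowN_of_quotAdjChainKernelCertTB` (`Rows/CorrWindowCertKernelChainQuotAdjCloser.lean`). Trust base: the Lean kernel (std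
axioms). No number of record; no existing claim node discharged; CONTROL/CALIBRATION context (wording (xx1)); silent on ρ_s = 0 /
presence / T_c / phase; nothing about La₂CuO₄; no summit statement is proved by this file. Seat hubbard-obs-p2 (STIFFNESS),
`prover-hubbard-obs-p2-g23-0`, zero compute.

References: X. Han, arXiv:2006.06002 §3 [Han2020Bootstrap]; J. Wang et al., PRX 14 (2024) 031006 §III [WangEtAl2024];
C. Jansson, D. Chaykin, C. Keil, SIAM J. Numer. Anal. 46 (2008) 180 [JanssonChaykinKeil2008].
-/

namespace Summit.Ventures.CertifiedManyBodySolver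

namespace CARPolyWindow

namespace Toy3x3

open Summit.Ventures.CertifiedQuantumChemistry Summit.Ventures.CertifiedQuantumChemistry.CARPoly
open Literature.MathematicalPhysics.QuantumLattice Literature.MathematicalPhysics.QuantumLattice.HubbardWave0
open Literature.MathematicalPhysics.QuantumManyBody.StateRelaxation
open Literature.Probability.LatticeModels ThermodynamicLimit Filter Topology
open Matrix
open scoped ComplexOrder BigOperators

/-! ## The objective (everything else from `…_bondRowQuot`) -/

/-- The objective: ONE orientation of the `↓`-spin bond word, `2·c†_{0↓} c_{e₁↓}` (not Hermitian). [folklore] -/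
def TXh : Terms (Orb (Fin 9)) := [([(orb 0 1, true), (orb 1 1, false)], 2)]

/-- The sliced residual WITHOUT symmetry slices (head; one Gram slice; charged; anti-Hermitian), regrouped `[1, 1 | rest]` into 3
chain slices. [cite: WangEtAl2024, §III] -/
def toyHSlices : List (Terms (Orb (Fin 9))) :=
  groupSlices (residTGslices TXh muq 0 (fun σ => orb (ix 0) σ) 0 0 0 0 TE (gramTBslices 0 blocksq) TH Dq.f []
    (fun l : Fin 0 => l.elim0) (fun l : Fin 0 => l.elim0) [] []) [1, 1]

/-- The hint lists (as in `…_bondRowQuot`): ONE translation hint on the Gram slice. [cite: Han2020Bootstrap, §3] -/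
def toyHHints : List (List (QHint 1)) := [[], [⟨0, (1, 0), ([orb 0 1], [orb 0 1])⟩], []]

/-! ## The accumulators (elaboration-time literals) and the per-step KERNEL facts -/

/-- Accumulator after step 1 (head slice): `eval%` literal. [folklore] -/
def toyHC1 : SOSDual.EncPoly := eval% stepEQA Dq 32 ([] : SOSDual.EncPoly) (toyHSlices.getD 0 []) (toyHHints.getD 0 [])

/-- Accumulator after step 2 (the Gram slice, quotiented by the accepted hint): `eval%` literal. [folklore] -/
def toyHC2 : SOSDual.EncPoly := eval% stepEQA Dq 32 toyHC1 (toyHSlices.getD 1 []) (toyHHints.getD 1 [])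

/-- Accumulator after step 3 (empty tail): `eval%` literal. [folklore] -/
def toyHC3 : SOSDual.EncPoly := eval% stepEQA Dq 32 toyHC2 (toyHSlices.getD 2 []) (toyHHints.getD 2 [])

/-- The accumulator list. [folklore] -/
def toyHCs : List SOSDual.EncPoly := [[], toyHC1, toyHC2, toyHC3]

/-- KERNEL FACT, step 1 of 3. [folklore] -/
theorem toyH_step_0 : toyHCs.getD (0 + 1) [] = stepEQA Dq 32 (toyHCs.getD 0 []) (toyHSlices.getD 0 []) (toyHHints.getD 0 []) :=
  eq_of_beq (by decide +kernel)

/-- KERNEL FACT, step 2 of 3 (hint applied AND the adjoint pass replaces `c†_{e₁↓}c_{0↓}` by `c†_{0↓}c_{e₁↓}`). [folklore] -/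
theorem toyH_step_1 : toyHCs.getD (1 + 1) [] = stepEQA Dq 32 (toyHCs.getD 1 []) (toyHSlices.getD 1 []) (toyHHints.getD 1 []) :=
  eq_of_beq (by decide +kernel)

/-- KERNEL FACT, step 3 of 3. [folklore] -/
theorem toyH_step_2 : toyHCs.getD (2 + 1) [] = stepEQA Dq 32 (toyHCs.getD 2 []) (toyHSlices.getD 2 []) (toyHHints.getD 2 []) :=
  eq_of_beq (by decide +kernel)

/-- **The hinted chain record**, assembled by pattern matching on `Fin 3`. [cite: JanssonChaykinKeil2008, §3] -/
theorem toyH_chain_ok : ChainQAOK Dq 32 3 toyHCs toyHSlices toyHHints where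
  len := by decide +kernel
  step i := match i with
    | ⟨0, _⟩ => toyH_step_0
    | ⟨1, _⟩ => toyH_step_1
    | ⟨2, _⟩ => toyH_step_2
    | ⟨n + 3, h⟩ => absurd h (by omega)

/-- Hint accepted AND anti-Hermitian residue absorbed: the last accumulator is EMPTY. Decided by the kernel. [folklore] -/
theorem toyH_last_nil : toyHCs.getD 3 [] = [] := by decide +kernel

/-- **The ONE rational inequality on the last accumulator**: `−7/8 ≤ lowerConst (decPoly 9 C₃) + (μ_↑ + μ_↓)(n₀/2 − ν)`.
[cite: WangEtAl2024, §III] -/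
theorem toyH_lowerConst :
    (-7 / 8 : ℚ) ≤ lowerConst (SOSDual.decPoly 9 (toyHCs.getD 3 [])) + (muq 0 + muq 1) * ((7 / 8 : ℚ) / 2 - 0) := by
  decide +kernel

/-! ## The end-to-end theorem -/

/-- Membership-proof irrelevance for ordered sites. [folklore] -/
private theorem pt_congr_site₈ {V : Finset (Site 2)} {x y : Site 2} (hx : x ∈ V) (hy : y ∈ V) (h : x = y) :
    PolySite.pt x hx = PolySite.pt y hy := by
  subst h; rfl

/-- **STEP-0, quotient + adjoint edition: the affine-N claim-node predicate for `2·c†_{0↓}c_{e₁↓}` at `(1, −3/10, 29/5)`, value `−7/8`,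
slope `−1` at `n₀ = 7/8`, orbit set `{1}`, from the 3-step `stepEQA` chain — ZERO hypotheses, no symmetry or adjoint data.**
[cite: WangEtAl2024, §III] [cite: Han2020Bootstrap, §3] -/
theorem toyH_affineOrbitLowerRowN :
    SquareTTPrimeCorrAffineOrbitLowerRowN (((-3 / 10 : ℚ)) : ℝ) (((29 / 5 : ℚ)) : ℝ) (-7 / 8) 0 0 0 0 (-1) (7 / 8) {1} W
      (termOp d TXh) := by
  have hz : (0 : Site 2) ∈ W := zero_mem_thicken_zero 1
  have h1 : (1 : DihedralGroup 4) ∈ ({1} : Finset (DihedralGroup 4)) := Finset.mem_singleton_self 1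
  have hmul : ∀ a ∈ ({1} : Finset (DihedralGroup 4)), ∀ b ∈ ({1} : Finset (DihedralGroup 4)),
      a * b ∈ ({1} : Finset (DihedralGroup 4)) := by
    intro a ha b hb
    rw [Finset.mem_singleton] at ha hb ⊢
    rw [ha, hb, mul_one]
  have hΛ : ({0} : Finset (Site 2)) ⊆ W := Finset.singleton_subset_iff.2 hz
  have hx0 : xs 0 = 0 := xs_zero
  have hix0 : xs (ix 0) = 0 := xs_ix_of_mem 0 hz
  have ho : ∀ σ : Fin 2, d (orb (ix 0) σ) = orb (PolySite.pt 0 hz) σ := by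
    intro σ
    rw [d_orb, pt_congr_site₈ (xs_mem (ix 0)) hz hix0]
  have hxsβ : ∀ j : Fin 1, Dq.xsβ j ∈ ({0} : Finset (Site 2)) := fun _ => Finset.mem_singleton_self 0
  have hcovβ : ∀ x ∈ ({0} : Finset (Site 2)), ∃ j : Fin 1, Dq.xsβ j = x := by
    intro x hx
    rw [Finset.mem_singleton] at hx
    exact ⟨0, hx.symm⟩
  have hdΛ : ∀ (j : Fin 1) (σ : Fin 2), dΛq (orb j σ) = orb (PolySite.pt (Dq.xsβ j) (hxsβ j)) σ := fun _ _ => rfl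
  have hf : ∀ b : Orb (Fin 1), d (Dq.f b) = Orb.embMap (PolySite.incl hΛ) (dΛq b) := by
    intro b
    show d (orb 0 (ofLex b).2) = _
    rw [d_orb, pt_congr_site₈ (xs_mem 0) (hΛ (Finset.mem_singleton_self 0)) hx0]
    rfl
  have hokS : ∀ (γc : Fin 8) (v : ℤ × ℤ), Dq.ok γc v = true → d4OfCode γc ∈ ({1} : Finset (DihedralGroup 4)) := by
    intro γc v h
    have h' : γc = 0 ∧ v = ((1 : ℤ), (0 : ℤ)) := of_decide_eq_true h
    rw [h'.1]
    exact h1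
  have hokV : ∀ (γc : Fin 8) (v : ℤ × ℤ), Dq.ok γc v = true → ∀ j : Fin 1,
      Dq.xs (Dq.ix (d4Vec (d4OfCode γc) (Dq.xsβ j) + siteOfPair v)) = d4Vec (d4OfCode γc) (Dq.xsβ j) + siteOfPair v := by
    intro γc v h j
    have h' : γc = 0 ∧ v = ((1 : ℤ), (0 : ℤ)) := of_decide_eq_true h
    obtain ⟨rfl, rfl⟩ := h'
    revert j
    decide
  have hH : termOp d TH = (hubbardTTPrimeFermionInteraction 1 (((-3 / 10 : ℚ)) : ℝ) (((29 / 5 : ℚ)) : ℝ)).localHamiltonian W := by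
    rw [TH, termOp_hamTermsIdx 1 (-3 / 10) (29 / 5) xs xs_mem xs_injective xs_cover d d_orb, Rat.cast_one]
  have hE : termOp d TE = fermionEmbed (PolySite.incl (subset_refl W))
      ((hubbardTTPrimeFermionInteraction 1 (((-3 / 10 : ℚ)) : ℝ) (((29 / 5 : ℚ)) : ℝ)).meanEnergyObs 1) := by
    rw [TE, termOp_energyTermsIdx 1 (-3 / 10) (29 / 5) xs xs_mem (subset_refl W) ix xs_ix_of_mem d d_orb, Rat.cast_one]
  exact affineOrbitLowerRowN_of_quotAdjChainKernelCertTB (-3 / 10) (29 / 5) (by norm_num) hΛ (subset_refl W) (subset_refl W) hz h1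
    hmul Dq xs_mem xs_ix_of_mem hxsβ hcovβ d d_injective d_orb 32 dΛq hdΛ hf (fun p => (ofLex p).2) (fun _ => rfl) hokS hokV
    TH hH TE hE (fun σ => orb (ix 0) σ) ho TXh muq 0 0 0 0 0 0 blocksq [] [] (fun wc hwc => absurd hwc List.not_mem_nil) []
    [1, 1] 3 toyHCs rfl toyHHints toyH_chain_ok (by norm_num [muq]) toyH_lowerConst

end Toy3x3

end CARPolyWindow

end Summit.Ventures.CertifiedManyBodySolver
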